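import Summits.QuantumAdvantage.AdviceFreeQNC0.WalkTransport
import HarnessLib

/-!
# Cell qa-qnc0 (rung (NP-Γ) `NPGamma37.RingHardSparse3`): the INSULATOR-INVOLUTION resonance MGF

Planner qa-qnc0-p2 gen 34 (INBOX P2-34c, ROUND-34P2 §4.4), brick (R′) of the sparse-coupling rung.

* `orbit_mgf` — ABSTRACT ORBIT AVERAGING: factors `g_j : α → ℝ≥0`, commuting data of involutions
  `φ₁ j, φ₂ j` fixing every other factor, and the Klein-four orbit bound `g_j(a) + g_j(φ₁a) + g_j(φ₂a) +
  g_j(φ₁φ₂a) ≤ 6` give `Σ_a Π_{j∈S} g_j(a) ≤ |α|·(3/2)^{|S|}` (the skeleton of (NP₁)'s `resonanceMGF`).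
* `blockCpl s t` — complement the walk bits on `[s, t]`; `xN_blockCpl_*` — it flips exactly the two
  boundary pattern bits `x_s`, `x_{t+1}` (`xN` = the `ℕ`-indexed `xOfU`).
* `no_three` / `four_orbit_le` — for fixed `cA cB cAB`, `m ≠ 0`, `κ ≠ 0` the letter `m·slope + κ`
  vanishes on at most two of the four sign patterns (`decide`).
* **`resonance_windows`** — for windows `q j < p j < p j + 1 < q (j+1)` (`j < F`, `q F < n`), coefficient
  functions `cA cB cAB κ : Fin F → (walk space) → ℤ/3` invariant under every `L_j = blockCpl (q j) (p j − 1)`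
  and `R_j = blockCpl (p j + 1) (q (j+1) − 1)` with `κ ≠ 0`, and `m ≠ 0`:
  `Σ_a 2^{#{j : m·slope(cA_j a, cB_j a, cAB_j a, x_{p_j}(a), x_{p_j+1}(a)) + κ_j a = 0}} ≤ 2ⁿ·(3/2)^F`.

In (NP-Γ) the invariance is discharged from (H1)(H2) of `InsulatedWindows` (the coefficients are
polynomials in the variables COUPLED to the pair, none of which is a boundary bit of any block) and
`κ_j = σ·λ_{jg}·sg(u_{p_j})` (no block contains a `p_j`).  WHAT THIS IS NOT: no statement about
polynomials or the game; (E′)/(A′) of the rung are separate files; crux 22907 untouched.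
-/

noncomputable section

namespace Summit.QuantumAdvantage.AdviceFreeQNC0.Resonance37G

open Finset
open Classical

/-! ### 1. Abstract orbit averaging -/

/-- Klein-four resonance count: if no three of four decidable events hold simultaneously, `Σ (if P_i then 2 else 1) ≤ 6`. -/
theorem four_orbit_le {P1 P2 P3 P4 : Prop} [Decidable P1] [Decidable P2] [Decidable P3] [Decidable P4]
    (h : ¬ (P1 ∧ P2 ∧ P3) ∧ ¬ (P1 ∧ P2 ∧ P4) ∧ ¬ (P1 ∧ P3 ∧ P4) ∧ ¬ (P2 ∧ P3 ∧ P4)) :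
    (if P1 then (2 : ℝ) else 1) + (if P2 then (2 : ℝ) else 1) + (if P3 then (2 : ℝ) else 1)
      + (if P4 then (2 : ℝ) else 1) ≤ 6 := by
  obtain ⟨n123, n124, n134, n234⟩ := h
  by_cases h1 : P1 <;> by_cases h2 : P2 <;> by_cases h3 : P3 <;> by_cases h4 : P4
  · exact absurd ⟨h1, h2, h3⟩ n123
  · exact absurd ⟨h1, h2, h3⟩ n123
  · exact absurd ⟨h1, h2, h4⟩ n124
  · norm_num [h1, h2, h3, h4]
  · exact absurd ⟨h1, h3, h4⟩ n134
  · norm_num [h1, h2, h3, h4]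
  · norm_num [h1, h2, h3, h4]
  · norm_num [h1, h2, h3, h4]
  · exact absurd ⟨h2, h3, h4⟩ n234
  · norm_num [h1, h2, h3, h4]
  · norm_num [h1, h2, h3, h4]
  · norm_num [h1, h2, h3, h4]
  · norm_num [h1, h2, h3, h4]
  · norm_num [h1, h2, h3, h4]
  · norm_num [h1, h2, h3, h4]
  · norm_num [h1, h2, h3, h4]

/-- **Abstract orbit-averaging MGF.** -/
theorem orbit_mgf {α ι : Type*} [Fintype α] [DecidableEq ι] (S : Finset ι) (g : ι → α → ℝ)
    (φ₁ φ₂ : ι → α → α) (h₁ : ∀ j, Function.Involutive (φ₁ j)) (h₂ : ∀ j, Function.Involutive (φ₂ j))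
    (hfix₁ : ∀ j j', j ≠ j' → ∀ a, g j' (φ₁ j a) = g j' a)
    (hfix₂ : ∀ j j', j ≠ j' → ∀ a, g j' (φ₂ j a) = g j' a)
    (hnn : ∀ j a, 0 ≤ g j a)
    (h4 : ∀ j a, g j a + g j (φ₁ j a) + g j (φ₂ j a) + g j (φ₁ j (φ₂ j a)) ≤ 6) :
    ∑ a, ∏ j ∈ S, g j a ≤ (Fintype.card α : ℝ) * (3 / 2 : ℝ) ^ S.card := by
  induction S using Finset.induction_on with
  | empty => simp
  | insert j s hjs ih =>
    rw [card_insert_of_notMem hjs, pow_succ]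
    simp_rw [prod_insert hjs]
    set f : α → ℝ := fun a => ∏ x ∈ s, g x a with hf
    have hf1 : ∀ a, f (φ₁ j a) = f a := by
      intro a
      simp only [hf]
      refine prod_congr rfl fun x hx => ?_
      have hxj : j ≠ x := fun h => hjs (h ▸ hx)
      exact hfix₁ j x hxj a
    have hf2 : ∀ a, f (φ₂ j a) = f a := by
      intro a
      simp only [hf]
      refine prod_congr rfl fun x hx => ?_
      have hxj : j ≠ x := fun h => hjs (h ▸ hx)
      exact hfix₂ j x hxj a
    have hfnn : ∀ a, 0 ≤ f a := fun a => prod_nonneg fun x _ => hnn x a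
    have hs1 : ∑ a, g j (φ₁ j a) * f a = ∑ a, g j a * f a := by
      calc ∑ a, g j (φ₁ j a) * f a = ∑ a, g j (φ₁ j a) * f (φ₁ j a) := by simp_rw [hf1]
        _ = ∑ a, g j a * f a := Equiv.sum_comp ((h₁ j).toPerm _) (fun a => g j a * f a)
    have hs2 : ∑ a, g j (φ₂ j a) * f a = ∑ a, g j a * f a := by
      calc ∑ a, g j (φ₂ j a) * f a = ∑ a, g j (φ₂ j a) * f (φ₂ j a) := by simp_rw [hf2]
        _ = ∑ a, g j a * f a := Equiv.sum_comp ((h₂ j).toPerm _) (fun a => g j a * f a)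
    have hs12 : ∑ a, g j (φ₁ j (φ₂ j a)) * f a = ∑ a, g j a * f a := by
      calc ∑ a, g j (φ₁ j (φ₂ j a)) * f a = ∑ a, g j (φ₁ j (φ₂ j a)) * f (φ₁ j (φ₂ j a)) := by
            simp_rw [hf1, hf2]
        _ = ∑ a, g j (φ₁ j a) * f (φ₁ j a) :=
            Equiv.sum_comp ((h₂ j).toPerm _) (fun a => g j (φ₁ j a) * f (φ₁ j a))
        _ = ∑ a, g j a * f a := Equiv.sum_comp ((h₁ j).toPerm _) (fun a => g j a * f a)
    have h4' : 4 * ∑ a, g j a * f a ≤ 6 * ∑ a, f a := by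
      calc 4 * ∑ a, g j a * f a
          = ∑ a, g j a * f a + ∑ a, g j (φ₁ j a) * f a + ∑ a, g j (φ₂ j a) * f a
              + ∑ a, g j (φ₁ j (φ₂ j a)) * f a := by rw [hs1, hs2, hs12]; ring
        _ = ∑ a, (g j a + g j (φ₁ j a) + g j (φ₂ j a) + g j (φ₁ j (φ₂ j a))) * f a := by
            simp only [← sum_add_distrib, add_mul]
        _ ≤ ∑ a, 6 * f a := sum_le_sum fun a _ => mul_le_mul_of_nonneg_right (h4 j a) (hfnn a)
        _ = 6 * ∑ a, f a := by rw [mul_sum]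
    have hmain : ∑ a, g j a * f a ≤ (Fintype.card α : ℝ) * ((3 / 2 : ℝ) ^ s.card * (3 / 2)) := by
      have h2 : (0 : ℝ) ≤ (Fintype.card α : ℝ) * (3 / 2 : ℝ) ^ s.card := by positivity
      nlinarith [h4', ih, h2]
    simpa [hf] using hmain

/-! ### 2. The four-pattern resonance count -/

/-- sign `1 − 2x ∈ ℤ/3` of a bit. -/
def sg (x : Bool) : ZMod 3 := if x then 2 else 1

/-- the bit as an element of `ℤ/3`. -/
def bt (x : Bool) : ZMod 3 := if x then 1 else 0

/-- `sg (¬b) = − sg b`. -/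
theorem sg_not (b : Bool) : sg (!b) = -sg b := by cases b <;> decide

/-- the `v`-slope of `cA·x_A + cB·x_B + cAB·x_A·x_B` along the joint flip of the pair, read at `(x_A, x_B)`
(identical to `NPGamma37.slope`). -/
def slope (cA cB cAB : ZMod 3) (xA xB : Bool) : ZMod 3 :=
  sg xA * cA + sg xB * cB + cAB * (bt xA * sg xB + bt xB * sg xA + sg xA * sg xB)

/-- The slope unfolded: value of the pair form after the joint flip minus its value before. -/
theorem slope_eq (cA cB cAB : ZMod 3) (xA xB : Bool) :
    slope cA cB cAB xA xB =
      (cA * bt (!xA) + cB * bt (!xB) + cAB * (bt (!xA) * bt (!xB)))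
        - (cA * bt xA + cB * bt xB + cAB * (bt xA * bt xB)) := by
  revert cA cB cAB xA xB; decide

set_option synthInstance.maxHeartbeats 400000 in
set_option synthInstance.maxSize 4096 in
/-- at most two of the four sign patterns resonate. -/
theorem no_three : ∀ (cA cB cAB m κ : ZMod 3) (xA xB : Bool), m ≠ 0 → κ ≠ 0 →
    ¬ (m * slope cA cB cAB xA xB + κ = 0 ∧ m * slope cA cB cAB (!xA) xB + κ = 0 ∧
        m * slope cA cB cAB xA (!xB) + κ = 0) ∧
    ¬ (m * slope cA cB cAB xA xB + κ = 0 ∧ m * slope cA cB cAB (!xA) xB + κ = 0 ∧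
        m * slope cA cB cAB (!xA) (!xB) + κ = 0) ∧
    ¬ (m * slope cA cB cAB xA xB + κ = 0 ∧ m * slope cA cB cAB xA (!xB) + κ = 0 ∧
        m * slope cA cB cAB (!xA) (!xB) + κ = 0) ∧
    ¬ (m * slope cA cB cAB (!xA) xB + κ = 0 ∧ m * slope cA cB cAB xA (!xB) + κ = 0 ∧
        m * slope cA cB cAB (!xA) (!xB) + κ = 0) := by
  decide

/-! ### 3. Block complements of the walk word -/

variable {n : ℕ}

/-- complement the walk bits on the block `[s, t]`. -/
def blockCpl (s t : ℕ) (a : Fin n → Bool) : Fin n → Bool :=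
  fun i => if s ≤ i.val ∧ i.val ≤ t then !a i else a i

/-- A block complement is an involution. -/
theorem blockCpl_blockCpl (s t : ℕ) (a : Fin n → Bool) : blockCpl s t (blockCpl s t a) = a := by
  funext i
  unfold blockCpl
  by_cases h : s ≤ i.val ∧ i.val ≤ t
  · simp [h]
  · simp [h]

/-- A block complement is an involution (bundled form). -/
theorem blockCpl_involutive (s t : ℕ) : Function.Involutive (blockCpl (n := n) s t) :=
  fun a => blockCpl_blockCpl s t a

/-- A block complement does not change coordinates outside the block. -/
theorem blockCpl_apply_of_not_mem (s t : ℕ) (a : Fin n → Bool) {i : Fin n} (h : ¬ (s ≤ i.val ∧ i.val ≤ t)) :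
    blockCpl s t a i = a i := by
  unfold blockCpl; rw [if_neg h]

/-- The extended input after a block complement: negated exactly inside the block (and below `n`). -/
theorem uExt_blockCpl (s t : ℕ) (a : Fin n → Bool) (m : ℕ) :
    uExt (blockCpl s t a) m = if s ≤ m ∧ m ≤ t ∧ m < n then !uExt a m else uExt a m := by
  unfold uExt blockCpl
  by_cases hm : m < n
  · simp only [hm, dif_pos, and_true]
  · simp only [hm, dif_neg, not_false_eq_true, and_false, if_false]

/-- the `ℕ`-indexed pattern bit `x_i = ¬(u_i ⊕ u_{i-1})` (`u_{-1} = 0`, `u_m = 1` for `m ≥ n`); equals `xOfU a ⟨i, _⟩`. -/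
def xN (a : Fin n → Bool) (i : ℕ) : Bool :=
  !(xor (uExt a i) (if i = 0 then false else uExt a (i - 1)))

/-- The ℕ-indexed walk bit `xN` agrees with `xOfU` on `Fin (n+1)`. -/
theorem xN_eq_xOfU (a : Fin n → Bool) (i : Fin (n + 1)) : xN a i.val = xOfU a i := rfl

/-- a block complement does not move the pattern bits away from the two boundaries. -/
theorem xN_blockCpl_of_ne (s t : ℕ) (hst : s ≤ t) (htn : t < n) (a : Fin n → Bool) (i : ℕ) (h1 : i ≠ s)
    (h2 : i ≠ t + 1) :
    xN (blockCpl s t a) i = xN a i := by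
  unfold xN
  rw [uExt_blockCpl, uExt_blockCpl]
  by_cases hi0 : i = 0
  · subst hi0
    have : ¬ (s ≤ 0 ∧ 0 ≤ t ∧ 0 < n) := by omega
    rw [if_neg this]
  · rw [if_neg hi0, if_neg hi0]
    by_cases hin : s ≤ i ∧ i ≤ t ∧ i < n
    · have hin' : s ≤ i - 1 ∧ i - 1 ≤ t ∧ i - 1 < n := by omega
      rw [if_pos hin, if_pos hin']
      cases uExt a i <;> cases uExt a (i - 1) <;> rfl
    · rw [if_neg hin]
      by_cases hn : i < n + 1
      · have hin' : ¬ (s ≤ i - 1 ∧ i - 1 ≤ t ∧ i - 1 < n) := by omega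
        rw [if_neg hin']
      · -- beyond the word: both extensions are the constant `true` unless flipped; `i - 1 ≥ n`
        have hin' : ¬ (s ≤ i - 1 ∧ i - 1 ≤ t ∧ i - 1 < n) := by omega
        rw [if_neg hin']

/-- … flips the left boundary bit `x_s` (when `s ≤ t`, `s ≤ n`)… -/
theorem xN_blockCpl_left (s t : ℕ) (hst : s ≤ t) (hsn : s < n) (a : Fin n → Bool) :
    xN (blockCpl s t a) s = !xN a s := by
  unfold xN
  rw [uExt_blockCpl, uExt_blockCpl]
  have hin : s ≤ s ∧ s ≤ t ∧ s < n := ⟨le_rfl, hst, hsn⟩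
  rw [if_pos hin]
  by_cases hs0 : s = 0
  · rw [if_pos hs0, if_pos hs0]
    cases uExt a s <;> rfl
  · have hin' : ¬ (s ≤ s - 1 ∧ s - 1 ≤ t ∧ s - 1 < n) := by omega
    rw [if_neg hs0, if_neg hs0, if_neg hin']
    cases uExt a s <;> cases uExt a (s - 1) <;> rfl

/-- … and the right boundary bit `x_{t+1}` (when `s ≤ t < n`). -/
theorem xN_blockCpl_right (s t : ℕ) (hst : s ≤ t) (htn : t < n) (a : Fin n → Bool) :
    xN (blockCpl s t a) (t + 1) = !xN a (t + 1) := by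
  unfold xN
  rw [uExt_blockCpl, uExt_blockCpl]
  have hin : ¬ (s ≤ t + 1 ∧ t + 1 ≤ t ∧ t + 1 < n) := by omega
  have hin' : s ≤ t + 1 - 1 ∧ t + 1 - 1 ≤ t ∧ t + 1 - 1 < n := by omega
  rw [if_neg hin, if_neg (show t + 1 ≠ 0 by omega), if_neg (show t + 1 ≠ 0 by omega), if_pos hin']
  cases uExt a (t + 1) <;> cases uExt a (t + 1 - 1) <;> rfl

/-! ### 4. The resonance MGF for an insulated window system -/

/-- invariance of a coefficient function under all the insulator involutions. -/
def Inv (F : ℕ) (p q : ℕ → ℕ) (f : (Fin n → Bool) → ZMod 3) : Prop :=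
  ∀ j < F, ∀ a, f (blockCpl (q j) (p j - 1) a) = f a ∧ f (blockCpl (p j + 1) (q (j + 1) - 1) a) = f a

/-- the letter of window `j`. -/
def letter (m : ZMod 3) (cA cB cAB κ : (Fin n → Bool) → ZMod 3) (pj : ℕ) (a : Fin n → Bool) : ZMod 3 :=
  m * slope (cA a) (cB a) (cAB a) (xN a pj) (xN a (pj + 1)) + κ a

/-- **(R′) THE RESONANCE MGF FOR INSULATED WINDOWS.** -/
theorem resonance_windows (F : ℕ) (p q : ℕ → ℕ)
    (hord : ∀ j < F, q j < p j ∧ p j + 1 < q (j + 1)) (hqF : q F < n)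
    (m : ZMod 3) (hm : m ≠ 0) (cA cB cAB κ : Fin F → (Fin n → Bool) → ZMod 3)
    (hA : ∀ j, Inv F p q (cA j)) (hB : ∀ j, Inv F p q (cB j)) (hAB : ∀ j, Inv F p q (cAB j))
    (hκ : ∀ j, Inv F p q (κ j)) (hκ0 : ∀ j a, κ j a ≠ 0) :
    (∑ a : Fin n → Bool, (2 : ℝ) ^ (univ.filter fun j : Fin F =>
        letter m (cA j) (cB j) (cAB j) (κ j) (p j) a = 0).card)
      ≤ (2 : ℝ) ^ n * (3 / 2 : ℝ) ^ F := by
  -- monotonicity of the insulators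
  have hqmono : ∀ i j : ℕ, i ≤ j → j ≤ F → q i ≤ q j := by
    intro i j hij hjF
    induction j with
    | zero =>
      have : i = 0 := by omega
      subst this; exact le_rfl
    | succ j ih =>
      by_cases hij' : i = j + 1
      · subst hij'; exact le_rfl
      · have h1 := ih (by omega) (by omega)
        have h2 := hord j (by omega)
        omega
  -- positions
  have hpos : ∀ j : Fin F, q j < p j ∧ p j + 1 < q (j + 1) ∧ q (j + 1) ≤ q F := fun j =>
    ⟨(hord j j.2).1, (hord j j.2).2, hqmono (j + 1) F (by have := j.2; omega) le_rfl⟩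
  have hsep : ∀ j j' : Fin F, j.val < j'.val → p j + 1 < q (j + 1) ∧ q (j + 1) ≤ q j' ∧ q j' < p j' :=
    fun j j' hjj => ⟨(hord j j.2).2, hqmono (j + 1) j' (by omega) (by have := j'.2; omega), (hord j' j'.2).1⟩
  -- the factors and involutions
  set g : Fin F → (Fin n → Bool) → ℝ := fun j a =>
    if letter m (cA j) (cB j) (cAB j) (κ j) (p j) a = 0 then 2 else 1 with hg
  set φ₁ : Fin F → (Fin n → Bool) → (Fin n → Bool) := fun j => blockCpl (q j) (p j - 1) with hφ₁
  set φ₂ : Fin F → (Fin n → Bool) → (Fin n → Bool) := fun j => blockCpl (p j + 1) (q (j + 1) - 1) with hφ₂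
  have hprod : ∀ a : Fin n → Bool,
      (2 : ℝ) ^ (univ.filter fun j : Fin F => letter m (cA j) (cB j) (cAB j) (κ j) (p j) a = 0).card
        = ∏ j ∈ (univ : Finset (Fin F)), g j a := by
    intro a
    rw [hg]
    simp only
    rw [prod_ite, prod_const, prod_const_one, mul_one]
  simp_rw [hprod]
  have hmain := orbit_mgf (univ : Finset (Fin F)) g φ₁ φ₂
    (fun j => blockCpl_involutive _ _) (fun j => blockCpl_involutive _ _) ?_ ?_
    (fun j a => by simp only [hg]; split_ifs <;> norm_num) ?_
  · simpa [card_univ, Fintype.card_fin, Fintype.card_bool, Fintype.card_fun] using hmain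
  · -- φ₁ j fixes the letter of j' ≠ j
    intro j j' hjj a
    simp only [hg, hφ₁]
    have hl : letter m (cA j') (cB j') (cAB j') (κ j') (p j') (blockCpl (q j) (p j - 1) a)
        = letter m (cA j') (cB j') (cAB j') (κ j') (p j') a := by
      unfold letter
      rw [((hA j') j j.2 a).1, ((hB j') j j.2 a).1, ((hAB j') j j.2 a).1, ((hκ j') j j.2 a).1]
      have hq := hpos j
      have hq' := hpos j'
      rcases lt_or_gt_of_ne (fun h : j.val = j'.val => hjj (Fin.ext h)) with hlt | hgt
      · have hs := hsep j j' hlt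
        rw [xN_blockCpl_of_ne _ _ (by omega) (by omega) a (p j') (by omega) (by omega),
          xN_blockCpl_of_ne _ _ (by omega) (by omega) a (p j' + 1) (by omega) (by omega)]
      · have hs := hsep j' j hgt
        rw [xN_blockCpl_of_ne _ _ (by omega) (by omega) a (p j') (by omega) (by omega),
          xN_blockCpl_of_ne _ _ (by omega) (by omega) a (p j' + 1) (by omega) (by omega)]
    rw [hl]
  · -- φ₂ j fixes the letter of j' ≠ j
    intro j j' hjj a
    simp only [hg, hφ₂]
    have hl : letter m (cA j') (cB j') (cAB j') (κ j') (p j') (blockCpl (p j + 1) (q (j + 1) - 1) a)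
        = letter m (cA j') (cB j') (cAB j') (κ j') (p j') a := by
      unfold letter
      rw [((hA j') j j.2 a).2, ((hB j') j j.2 a).2, ((hAB j') j j.2 a).2, ((hκ j') j j.2 a).2]
      have hq := hpos j
      have hq' := hpos j'
      rcases lt_or_gt_of_ne (fun h : j.val = j'.val => hjj (Fin.ext h)) with hlt | hgt
      · have hs := hsep j j' hlt
        rw [xN_blockCpl_of_ne _ _ (by omega) (by omega) a (p j') (by omega) (by omega),
          xN_blockCpl_of_ne _ _ (by omega) (by omega) a (p j' + 1) (by omega) (by omega)]
      · have hs := hsep j' j hgt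
        rw [xN_blockCpl_of_ne _ _ (by omega) (by omega) a (p j') (by omega) (by omega),
          xN_blockCpl_of_ne _ _ (by omega) (by omega) a (p j' + 1) (by omega) (by omega)]
    rw [hl]
  · -- the Klein-four orbit bound
    intro j a
    simp only [hg, hφ₁, hφ₂]
    have hq := hpos j
    unfold letter
    -- coefficients are invariant
    have cA1 := ((hA j) j j.2 a).1; have cB1 := ((hB j) j j.2 a).1
    have cAB1 := ((hAB j) j j.2 a).1; have κ1 := ((hκ j) j j.2 a).1
    have cA2 := ((hA j) j j.2 a).2; have cB2 := ((hB j) j j.2 a).2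
    have cAB2 := ((hAB j) j j.2 a).2; have κ2 := ((hκ j) j j.2 a).2
    set a₂ := blockCpl (p j + 1) (q (j + 1) - 1) a with ha₂
    have cA12 : cA j (blockCpl (q j) (p j - 1) a₂) = cA j a := by rw [((hA j) j j.2 a₂).1, cA2]
    have cB12 : cB j (blockCpl (q j) (p j - 1) a₂) = cB j a := by rw [((hB j) j j.2 a₂).1, cB2]
    have cAB12 : cAB j (blockCpl (q j) (p j - 1) a₂) = cAB j a := by rw [((hAB j) j j.2 a₂).1, cAB2]
    have κ12 : κ j (blockCpl (q j) (p j - 1) a₂) = κ j a := by rw [((hκ j) j j.2 a₂).1, κ2]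
    -- the pattern bits on the orbit
    have x1A : xN (blockCpl (q j) (p j - 1) a) (p j) = !xN a (p j) := by
      have := xN_blockCpl_right (q j) (p j - 1) (by omega) (by omega) a
      rwa [show p j - 1 + 1 = p j by omega] at this
    have x1B : xN (blockCpl (q j) (p j - 1) a) (p j + 1) = xN a (p j + 1) :=
      xN_blockCpl_of_ne _ _ (by omega) (by omega) a _ (by omega) (by omega)
    have x2A : xN a₂ (p j) = xN a (p j) := xN_blockCpl_of_ne _ _ (by omega) (by omega) a _ (by omega) (by omega)
    have x2B : xN a₂ (p j + 1) = !xN a (p j + 1) := xN_blockCpl_left _ _ (by omega) (by omega) a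
    have x12A : xN (blockCpl (q j) (p j - 1) a₂) (p j) = !xN a (p j) := by
      have := xN_blockCpl_right (q j) (p j - 1) (by omega) (by omega) a₂
      rw [show p j - 1 + 1 = p j by omega] at this
      rw [this, x2A]
    have x12B : xN (blockCpl (q j) (p j - 1) a₂) (p j + 1) = !xN a (p j + 1) := by
      rw [xN_blockCpl_of_ne _ _ (by omega) (by omega) a₂ _ (by omega) (by omega), x2B]
    rw [cA1, cB1, cAB1, κ1, cA2, cB2, cAB2, κ2, cA12, cB12, cAB12, κ12, x1A, x1B, x2A, x2B, x12A, x12B]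
    exact four_orbit_le (no_three (cA j a) (cB j a) (cAB j a) m (κ j a) (xN a (p j)) (xN a (p j + 1)) hm (hκ0 j a))

end Summit.QuantumAdvantage.AdviceFreeQNC0.Resonance37G
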